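import Literature.MathematicalPhysics.QuantumFieldTheory.Balaban1983to89.B13NodeTorusWalksRungWitness

/-!
# `Balaban1983to89.B13NodeTorusWalksRefRungWitness` — the REFERENCE-RUNG-SIDE HYPOTHESIS BLOCK of
# `B13NodeTorusWalksRefLeaves.b13Leaf_twoTorus_uniformWalksAcrossRef` (₄) is JOINTLY INHABITED, ∃-closed, across tori with
# genuine far-ness — WITH THE FORM BOUND `g` THE PACKAGE's NUMBER (not a free letter)

statement-level bookkeeping over published theorems with citation tags; kernel-checked compositions of tree theorems and
elementary real arithmetic; nothing here is a claim about the Yang–Mills mass gap.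

Cell `pub-ymgap`, D-0062 Track A, node N10 = [Balaban1988RG2Cluster] Lemmas 1–3; seat `dag-n10-c` g2, module 12 — the (A2) companion
of modules 8–10 (`B13NodeTorusWalksGammaLeaves` p463673, `B13NodeTorusWalksRefLeaves` p467638, `…N10AtRecord11B13WalksRef` p467660).

WHY.  Module 4 (`B13NodeTorusWalksRungWitness.rungBlock_oneSiteFamily_nonvacuous`, p459615) witnessed the rung-side block of the ₂ leaf
`b13Leaf_twoTorus_uniformWalksAcross₂` with NODE A's form bound as a FREE letter `g_q ≥ 0`.  Since module 6 (`gammaForm_le_of_termWalks`)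
that letter is the package's NUMBER `g = (B_Γc_V)(B_Γ·m c₀(1,η)^ν)∕m_A`, `B_Γ = K̄_L(4∕√m)c_V` — it READS the package, so «choose
`μ` large against `g`» is no longer obviously non-circular; and since modules 9–10 the displayed rung is the REFERENCE rung
`UniformWalksAcrossRef 𝓣 rf` with an accretivity radius `R₁` and four perturbative thresholds.  THIS FILE closes the `∃` for that
block: for EVERY configuration size `α ≥ 0`, fibre letter `m`, dimension bound `d_m` and model-independent part `B ∈ [0, ½)` of
(2.24)–(2.25), ONE reference package `rf = oneSitePackage μ R 1 1 η R_σ d_m` and ONE radius `R₁` are chosen BEFORE the family such that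
every rung-side binder of `b13Leaf_twoTorus_uniformWalksAcrossRef` holds, `hall` for EVERY family of one-site tori of dimension `≤ d_m`
whose site pair is `R_σ`-far (n10-b g6's `uniformWalksAcrossRef_oneSiteFamily`, p456213, BY NAME — no threshold needed for the
reference rung itself), tori of every size `≥ 2⌈R_σ⌉` qualifying.  ORDER OF CHOICES (no circularity): rates `ε = κ = 1`;
`η := etaMax` of the one-site package AT `μ = 2` (`etaMax` does not read `η`, `R`, `R_σ`, `R₁`, and is NON-DECREASING in `μ` —
§1 `etaMax_oneSite_mono`, the only new arithmetic: the Combes–Thomas rate `κ⋆ = min(κ_P∕4, mκ_P∕(8K̄_Pc_V₀+1))` with `m = μ∕2`,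
`K̄_P = μ` increases with `μ`); then `c_V = c₀(1,η)^{d_m}` is FIXED and the package's form bound obeys `c_E·g ≤ 128·m·c_V⁴∕μ`
(`c_E = 2∕m_{A,0} = 2∕μ`, `B_Γ² = 32c_V²∕μ`), so `μ := 2 + 128·m·c_V⁴∕(3δ)`, `δ = (½ − B)∕4`, makes it `≤ 3δ`; then
`rungLetters_of_package` (chain below `κ_C⋆`, `ϑ`, `θ₀`), `R₁ := α + 1 + α(4K̄+4)∕θ₀`, `R := 8c₀(1,½)^{d_m}R₁ + 8c_VR₁ + R₁ + 1`,
`R_σ := max(T, log 8c₀(1,½)^{d_m}, log 8c_V)` with `T` print's far-ness threshold — and the four perturbative thresholds read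
`8μ·c·e^{−R_σ} ≤ μ`, `8μ·c·R₁ ≤ μR`.
* §1 `kapStar_oneSite_mono`, `etaMax_oneSite_mono` — monotonicity in `μ`; `sq_BΓ_oneSite` (`B_Γ² = 32c_V²∕μ`), `form_budget_oneSite`
  (`c_E·g ≤ 3δ` at the chosen `μ`).
* §2 ★ `refRungBlock_oneSiteFamily_nonvacuous` — the ∃-closed joint witness, conjunct for conjunct in the binder names of
  `b13Leaf_twoTorus_uniformWalksAcrossRef` (`hall`, `hrf`, `hR₁`, `hR₁R`, `hPσ`, `hP₁`, `hAσ`, `hA₁`, `hp`, `hη`, `hαR`, `hKG`, `hKCs`,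
  `hθ₀`, `hαsmall`, `hRσlarge`, `hkap''`, `hk1`–`hk4`, `hθ₀le`, `hc0`, `hcE`, and `hθR1le`, `hsmallKθ`, the shapes of `hαc`, `hsmall`
  at every member dimension `ν ≤ d_m`).  Through `uniformWalksAcross_of_ref` ∕ `termWalks_of_ref_thresholds` it also re-witnesses the
  ₃ blocks with `g` the package number.  The two-torus-side binders of the leaf (index data, in-edges (1.24)∕(1.30), NODE A's
  structural inputs `hAs hlin hΨσ hΨτ`, `hH`, constant matching `hvol`, `hPa`) are NOT addressed here.

CITATIONS.  [Balaban1988RG2Cluster] (1.11) p. 5, p. 13, p. 15, (2.7) p. 13, (2.16) p. 16, (2.24)–(2.26) p. 17.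
[Balaban1985BackgroundPropagators] Thm 3.10 p. 416, Thm 3.12 p. 423.  [Balaban1984PropagatorsII] Lemma 2.1 (2.61) p. 234.

HONEST FRAMING: a degenerate finite-matrix MODEL (n10-b's one-site term) and elementary arithmetic inhabiting a hypothesis block;
NOTHING of Bałaban's operators; count-neutral Track-A side landing; N10 NOT discharged; NOT NODE O for his family; nothing continuum ∕
ℝ⁴ ∕ OS ∕ mass-gap ∕ Clay.  0 `sorry`, 0 `def`, no instance, no notation; standard axioms.
-/

noncomputable section

namespace Literature.MathematicalPhysics.QuantumFieldTheory.Balaban1983to89.B13NodeTorusWalksRefRungWitness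

open Metric Set Finset
open Literature.MathematicalPhysics.QuantumFieldTheory.Balaban1983to89
open Literature.MathematicalPhysics.QuantumFieldTheory.Balaban1983to89.B9Thm37GlueTorus (tdist1)
open Literature.MathematicalPhysics.QuantumFieldTheory.Balaban1983to89.B5TorusCover (UT)
open Literature.MathematicalPhysics.QuantumFieldTheory.Balaban1983to89.B13TermWalkData (TorusTerms)
open Literature.MathematicalPhysics.QuantumFieldTheory.Balaban1983to89.NodeOLettersOfWalksAcross (WalkPackage)
open Literature.MathematicalPhysics.QuantumFieldTheory.Balaban1983to89.NodeOLettersOfWalksPerturbative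
  (RefPackage UniformWalksAcrossRef)
open Literature.MathematicalPhysics.QuantumFieldTheory.Balaban1983to89.NodeOLettersOfWalksPerturbativeWitness
  (oneSitePackage oneSiteFamily uniformWalksAcrossRef_oneSiteFamily admissible_oneSitePackage)
open Literature.MathematicalPhysics.QuantumFieldTheory.Balaban1983to89.B13NodeTorusWalksRungWitness
  (rungLetters_of_package exists_far_sites derived_oneSite_indep etaMax_oneSite_indep_eta positiveRates_oneSite etaMax_pos
    etaMax_le_kapA)

/-! ## §1. The one-site package: `etaMax` is non-decreasing in `μ`; the form bound's budget -/

section OneSite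

/-- **The Combes–Thomas rate `κ⋆` of the one-site package is NON-DECREASING in `μ`**: `κ⋆ = min(κ∕4, (μ∕2)κ∕(8μc_V₀+1))` with
`c_V₀ = c₀(1,κ∕2)^{d_m}` not reading `μ`, and `μ ↦ μ∕(8c_V₀μ + 1)` increases.  Pure arithmetic. [cite: Balaban1988RG2Cluster, (2.7) p.13, (2.16) p.16] -/
theorem kapStar_oneSite_mono {μ μ' R R' ε κ η η' Rσ Rσ' R₁ R₁' : ℝ} {dm : ℕ} (hκ : 0 < κ) (hμ : 0 < μ) (hμμ' : μ ≤ μ') :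
    ((oneSitePackage μ R ε κ η Rσ dm).toWalkPackage R₁).kapStar ≤
      ((oneSitePackage μ' R' ε κ η' Rσ' dm).toWalkPackage R₁').kapStar := by
  have hc : 0 ≤ ((1 : ℕ) : ℝ) * B6.c0 1 (κ / 2) ^ dm :=
    mul_nonneg (Nat.cast_nonneg _) (pow_nonneg (RefPackage.c0_nonneg (by linarith)) _)
  show min (κ / 4) (μ / 2 * κ / (8 * μ * (((1 : ℕ) : ℝ) * B6.c0 1 (κ / 2) ^ dm) + 1)) ≤
    min (κ / 4) (μ' / 2 * κ / (8 * μ' * (((1 : ℕ) : ℝ) * B6.c0 1 (κ / 2) ^ dm) + 1))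
  set cc : ℝ := ((1 : ℕ) : ℝ) * B6.c0 1 (κ / 2) ^ dm with hcc
  have hμ' : 0 < μ' := lt_of_lt_of_le hμ hμμ'
  have hd : 0 < 8 * μ * cc + 1 := by positivity
  have hd' : 0 < 8 * μ' * cc + 1 := by positivity
  refine min_le_min le_rfl ?_
  rw [div_le_div_iff₀ hd hd']
  have h1 : 0 ≤ (μ' - μ) * κ := mul_nonneg (sub_nonneg.2 hμμ') hκ.le
  nlinarith [mul_nonneg h1 hc]

/-- **`etaMax` of the one-site package is NON-DECREASING in `μ`** and reads neither `η` nor `(R, R_σ, R₁)`: choose `η := etaMax`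
at the smallest `μ` of a range FIRST, then `μ` as large as the budget requires — the order of choices of §2.
[cite: Balaban1988RG2Cluster, (2.16) p.16] -/
theorem etaMax_oneSite_mono {μ μ' R R' ε κ η η' Rσ Rσ' R₁ R₁' : ℝ} {dm : ℕ} (hκ : 0 < κ) (hμ : 0 < μ) (hμμ' : μ ≤ μ') :
    ((oneSitePackage μ R ε κ η Rσ dm).toWalkPackage R₁).etaMax ≤
      ((oneSitePackage μ' R' ε κ η' Rσ' dm).toWalkPackage R₁').etaMax := by
  have hk := kapStar_oneSite_mono (R := R) (R' := R') (ε := ε) (η := η) (η' := η') (Rσ := Rσ) (Rσ' := Rσ') (R₁ := R₁)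
    (R₁' := R₁') (dm := dm) hκ hμ hμμ'
  unfold WalkPackage.etaMax WalkPackage.mu WalkPackage.rhoE at *
  refine min_le_min (div_le_div_of_nonneg_right ?_ (by norm_num)) le_rfl
  exact min_le_min (min_le_min (min_le_min (min_le_min hk le_rfl) le_rfl) le_rfl) le_rfl

/-- **The Γ-letter of the one-site package squared**: `B_Γ² = 32·c_V²∕μ` (`K̄_L = 1`, `m = μ∕2`, `B_Γ = K̄_L(4∕√m)c_V`).
[cite: Balaban1988RG2Cluster, (2.16) p.16] -/
theorem sq_BΓ_oneSite {μ R ε κ η Rσ R₁ : ℝ} {dm : ℕ} (hμ : 0 < μ) :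
    ((oneSitePackage μ R ε κ η Rσ dm).toWalkPackage R₁).BΓ ^ 2 =
      32 * (oneSitePackage μ R ε κ η Rσ dm).cV ^ 2 / μ := by
  show ((1 : ℝ) * (4 / Real.sqrt (μ / 2)) * (oneSitePackage μ R ε κ η Rσ dm).cV) ^ 2 = _
  have hs : Real.sqrt (μ / 2) ^ 2 = μ / 2 := Real.sq_sqrt (by linarith)
  have hs0 : Real.sqrt (μ / 2) ≠ 0 := (Real.sqrt_pos.2 (by linarith)).ne'
  field_simp
  rw [hs]
  ring

/-- **THE FORM BOUND's BUDGET**: at the one-site package with `μ ≥ 1` and `μ·(3δ) ≥ 128·m·c_V⁴` the displayed number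
`g = (B_Γc_V)(B_Γ·m c₀(1,η)^ν)∕(μ∕2)` of the ₃∕₄ leaves obeys `(2∕μ)·g ≤ 3δ` at every member dimension `ν ≤ d_m` (`c₀(1,η)^ν ≤ c_V`
since `c₀ ≥ 1`).  Pure arithmetic. [cite: Balaban1988RG2Cluster, (2.16) p.16, (2.24)–(2.25) p.17] -/
theorem form_budget_oneSite {μ R ε κ η Rσ R₁ δ : ℝ} {dm m ν : ℕ} (hμ1 : 1 ≤ μ) (hη : 0 < η) (hν : ν ≤ dm)
    (hbud : 128 * m * (oneSitePackage μ R ε κ η Rσ dm).cV ^ 4 ≤ μ * (3 * δ)) :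
    2 / μ * ((((oneSitePackage μ R ε κ η Rσ dm).toWalkPackage R₁).BΓ * (oneSitePackage μ R ε κ η Rσ dm).cV) *
        (((oneSitePackage μ R ε κ η Rσ dm).toWalkPackage R₁).BΓ * (m * B6.c0 1 η ^ ν)) / (μ / 2)) ≤ 3 * δ := by
  have hμ : 0 < μ := by linarith
  set cV : ℝ := (oneSitePackage μ R ε κ η Rσ dm).cV with hcVdef
  set BG : ℝ := ((oneSitePackage μ R ε κ η Rσ dm).toWalkPackage R₁).BΓ with hBGdef
  have hc01 : 1 ≤ B6.c0 1 η := B6Lemma21Arith.one_le_c0 (by simpa using hη)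
  have hcV1 : 1 ≤ cV := by
    rw [hcVdef]; show 1 ≤ ((1 : ℕ) : ℝ) * B6.c0 1 η ^ dm
    rw [Nat.cast_one, one_mul]; exact one_le_pow₀ hc01
  have hcV0 : 0 ≤ cV := by linarith
  have hpow : B6.c0 1 η ^ ν ≤ cV := by
    rw [hcVdef]; show B6.c0 1 η ^ ν ≤ ((1 : ℕ) : ℝ) * B6.c0 1 η ^ dm
    rw [Nat.cast_one, one_mul]; exact pow_le_pow_right₀ hc01 hν
  have hsq : BG ^ 2 = 32 * cV ^ 2 / μ := sq_BΓ_oneSite hμ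
  have hm0 : (0 : ℝ) ≤ m := Nat.cast_nonneg m
  -- rewrite the number as `(B_Γ²)·(c_V·m·c₀^ν)·(4/μ²)` and bound `c₀^ν ≤ c_V`, `1/μ² ≤ 1`·…
  have e : 2 / μ * ((BG * cV) * (BG * (m * B6.c0 1 η ^ ν)) / (μ / 2)) =
      (BG ^ 2) * (cV * (m * B6.c0 1 η ^ ν)) * (4 / μ ^ 2) := by
    field_simp
    ring
  rw [e, hsq]
  have h1 : 32 * cV ^ 2 / μ * (cV * (m * B6.c0 1 η ^ ν)) * (4 / μ ^ 2) ≤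
      32 * cV ^ 2 / μ * (cV * (m * cV)) * (4 / μ ^ 2) := by
    have ha : 0 ≤ 32 * cV ^ 2 / μ := by positivity
    have hb : 0 ≤ 4 / μ ^ 2 := by positivity
    exact mul_le_mul_of_nonneg_right (mul_le_mul_of_nonneg_left
      (mul_le_mul_of_nonneg_left (mul_le_mul_of_nonneg_left hpow hm0) hcV0) ha) hb
  refine h1.trans ?_
  -- `128·m·c_V⁴/μ³ ≤ 128·m·c_V⁴/μ ≤ 3δ`
  have hμ3 : μ ≤ μ ^ 3 := by nlinarith
  have e2 : 32 * cV ^ 2 / μ * (cV * (m * cV)) * (4 / μ ^ 2) = 128 * m * cV ^ 4 / μ ^ 3 := by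
    field_simp
    ring
  rw [e2, div_le_iff₀ (by positivity)]
  calc 128 * m * cV ^ 4 ≤ μ * (3 * δ) := hbud
    _ ≤ 3 * δ * μ ^ 3 := by
        have hδ : 0 ≤ 3 * δ := by
          have : 0 ≤ 128 * (m : ℝ) * cV ^ 4 := by positivity
          nlinarith
        nlinarith [mul_le_mul_of_nonneg_left hμ3 hδ]

end OneSite

/-! ## §2. The reference-rung-side block of `b13Leaf_twoTorus_uniformWalksAcrossRef` is jointly inhabited -/

section Main

universe u

/-- ★ **THE REFERENCE-RUNG-SIDE BLOCK OF `b13Leaf_twoTorus_uniformWalksAcrossRef` IS JOINTLY INHABITED — ∃-CLOSED, ONE REFERENCE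
PACKAGE AND ONE RADIUS BEFORE THE FAMILY, GENUINE FAR-NESS, THE FORM BOUND THE PACKAGE's NUMBER.**  For every σ-dimension `d`, base size
`N'`, configuration space `E₀`, fibre letter `m`, dimension bound `d_m`, configuration size `α ≥ 0` and model-independent part
`B ∈ [0, ½)` of (2.24)–(2.25) (the leaf's `γ₂ + m′α₄M⁻⁴(1 + 32∕(κ₁−1))⁴`), there are `μ > 0`, a reference package
`rf = oneSitePackage μ R 1 1 η R_σ d_m`, a radius `R₁` and letters `K_G, K_Cs, θ₀, ϑ, κ, κ′, κ″, κ₂, c_E` such that — in the binder names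
of `B13NodeTorusWalksRefLeaves.b13Leaf_twoTorus_uniformWalksAcrossRef` — `hall` holds for EVERY family of one-site tori
(`NodeOLettersOfWalksPerturbativeWitness.oneSiteFamily`) of dimension `≤ d_m` whose site pair is `R_σ`-far, tori of every size `≥ 2⌈R_σ⌉`
qualify, and `hrf`, `hR₁`, `hR₁R`, the four perturbative thresholds `hPσ hP₁ hAσ hA₁`, `hp`, `hη`, `hαR`, `hKG`, `hKCs`, `hθ₀`, `hαsmall`,
`hRσlarge`, `hkap''`, `hk1`–`hk4`, `hθ₀le`, `hc0`, `hcE` hold, together with `hθR1le`, `hsmallKθ` and the shapes of `hαc`, `hsmall` — the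
latter WITH THE PACKAGE's NUMBER `g = (B_Γ·rf.cV)(B_Γ·m c₀(1,rf.η)^ν)∕(rf.mA₀∕2)` — at every member dimension `ν ≤ d_m`.  ORDER OF
CHOICES in the module header.  Degenerate model (σ- and `u`-independent one-site kernels); says nothing about Bałaban's kernels; the
two-torus-side binders of the leaf are NOT addressed here.
[cite: Balaban1988RG2Cluster, (1.11) p.5, p.13, p.15, (2.16) p.16, (2.24)–(2.26) p.17; Balaban1985BackgroundPropagators, Thm 3.10 p.416, Thm 3.12 p.423] -/
theorem refRungBlock_oneSiteFamily_nonvacuous (c : B13.Consts) (d N' : ℕ) (E₀ : Type) [NormedAddCommGroup E₀]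
    [NormedSpace ℂ E₀] (m dm : ℕ) {α B : ℝ} (hα : 0 ≤ α) (hB : 0 ≤ B) (hB2 : B < 1 / 2) :
    ∃ (μ : ℝ) (hμ : 0 < μ) (R η Rσ R₁ : ℝ) (rf : RefPackage) (KG KCs θ₀ ϑ kap kap' kap'' kap₂ cE : ℝ),
      rf = oneSitePackage μ R 1 1 η Rσ dm ∧
      -- `hall`: the reference rung across EVERY family of one-site tori of dimension `≤ d_m` with `R_σ`-far site pairs
      (∀ {S : Type u} (νs : S → ℕ) (Nfs : (s : S) → Fin (νs s) → ℕ) [∀ s i, NeZero (Nfs s i)]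
          (y₀ x₀ : (s : S) → UT (Nfs s)), (∀ s, νs s ≤ dm) → (∀ s, Rσ ≤ tdist1 (Nfs s) (y₀ s) (x₀ s)) →
          UniformWalksAcrossRef (oneSiteFamily (d := d) c N' E₀ νs Nfs y₀ x₀ hμ) rf) ∧
      -- such members exist at every torus size `n ≥ 2⌈R_σ⌉` (dimension one)
      (∀ n : ℕ, [NeZero n] → 2 * ⌈Rσ⌉₊ ≤ n →
          ∃ y₀ x₀ : UT (fun _ : Fin 1 => n), Rσ ≤ tdist1 (fun _ : Fin 1 => n) y₀ x₀) ∧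
      -- `hrf`, `hR₁`, `hR₁R`
      rf.Admissible ∧ 0 < R₁ ∧ R₁ < rf.R ∧
      -- the four perturbative thresholds `hPσ`, `hP₁`, `hAσ`, `hA₁`
      8 * rf.KbarP * rf.cV₀ * Real.exp (-(rf.εP * rf.Rσ)) ≤ rf.m₀ ∧ 8 * rf.KbarP * rf.cV₀ * R₁ ≤ rf.m₀ * rf.R ∧
      8 * rf.KbarA * rf.cV * Real.exp (-(rf.εA * rf.Rσ)) ≤ rf.mA₀ ∧ 8 * rf.KbarA * rf.cV * R₁ ≤ rf.mA₀ * rf.R ∧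
      -- `hp`, `hη`
      (rf.toWalkPackage R₁).PositiveRates ∧ rf.η ≤ (rf.toWalkPackage R₁).etaMax ∧
      -- `hαR`, `hKG`, `hKCs`, `hθ₀`, `hαsmall`, `hRσlarge`
      α < R₁ ∧ (rf.toWalkPackage R₁).Kbar ≤ KG ∧ 8 / rf.mA₀ ≤ KCs ∧ 0 < θ₀ ∧
      α ≤ θ₀ * R₁ / (4 * (rf.toWalkPackage R₁).Kbar + 4) ∧
      Real.log ((4 * (rf.toWalkPackage R₁).Kbar + 4) / θ₀)
        / ((rf.toWalkPackage R₁).mu / 4 - (rf.toWalkPackage R₁).kapCStar) ≤ rf.Rσ ∧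
      -- `hkap''`, `hk1`–`hk4`, `hθ₀le`
      0 < kap'' ∧ kap'' < kap' ∧ kap' < kap ∧ kap < kap₂ ∧ kap₂ < (rf.toWalkPackage R₁).kapCStar ∧ θ₀ ≤ ϑ ∧
      -- `hc0`, `hcE`
      0 ≤ cE ∧ 2 / rf.mA₀ ≤ cE ∧
      -- `hθR1le`, `hsmallKθ`, and the shapes of `hαc`, `hsmall` (WITH THE PACKAGE's `g`), at every member dimension `ν ≤ d_m`
      (∀ ν : ℕ, ν ≤ dm →
        (m * (1 + 2 / (kap - kap')) ^ ν) * (m * (1 + 2 / (kap' - kap'')) ^ ν)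
            * (θ₀ * KCs * KG
              + KG * (KCs * θ₀ * (m * (1 + 2 / ((rf.toWalkPackage R₁).kapCStar - kap₂)) ^ ν) * KCs
                * (m * (1 + 2 / (kap₂ - kap)) ^ ν)) * KG
              + KG * KCs * θ₀) ≤ ϑ ∧
        KCs * (m * (1 + 2 / kap) ^ ν) * (ϑ * (m * (1 + 2 / kap'') ^ ν)) < 1 ∧
        (2 * (ϑ * (m * (1 + 2 / kap'') ^ ν)) + B) * cE ≤ 1 / 2 ∧
        (2 * (ϑ * (m * (1 + 2 / kap'') ^ ν)) + B) * (1 + 2 * cE *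
          ((((rf.toWalkPackage R₁).BΓ * rf.cV) * ((rf.toWalkPackage R₁).BΓ * (m * B6.c0 1 rf.η ^ ν))) / (rf.mA₀ / 2)))
            ≤ 1 / 2) := by
  -- ORDER OF CHOICES. (1) `δ`; rates `ε = κ = 1`; `η := etaMax` AT `μ = 2` (does not read `η`, `R`, `R_σ`, `R₁`)
  set δ : ℝ := (1 / 2 - B) / 4 with hδdef
  have hδ : 0 < δ := by rw [hδdef]; linarith
  set q₀ : WalkPackage := (oneSitePackage 2 1 1 1 1 0 dm).toWalkPackage 1 with hq₀def
  have hq₀ : q₀.Admissible :=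
    RefPackage.admissible_toWalkPackage (admissible_oneSitePackage two_pos one_pos zero_le_one one_pos one_pos le_rfl)
      one_pos
  have hp₀ : q₀.PositiveRates := positiveRates_oneSite one_pos one_pos
  set ηs : ℝ := q₀.etaMax with hηsdef
  have hηs : 0 < ηs := etaMax_pos hq₀ hp₀
  have hηs1 : ηs ≤ 1 := etaMax_le_kapA hp₀
  -- (2) `c_V = c₀(1,η)^{d_m}` is now FIXED; `μ` LARGE against the form budget `128·m·c_V⁴` and `≥ 2`
  set cV : ℝ := ((1 : ℕ) : ℝ) * B6.c0 1 ηs ^ dm with hcVdef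
  have hcV0 : 0 ≤ cV := mul_nonneg (Nat.cast_nonneg _) (pow_nonneg (RefPackage.c0_nonneg hηs) _)
  set μ : ℝ := 2 + 128 * m * cV ^ 4 / (3 * δ) with hμdef
  have hG0 : 0 ≤ 128 * m * cV ^ 4 / (3 * δ) := by positivity
  have hμ2 : 2 ≤ μ := by rw [hμdef]; linarith
  have hμ : 0 < μ := by linarith
  have hμ1 : 1 ≤ μ := by linarith
  have hbud : 128 * m * cV ^ 4 ≤ μ * (3 * δ) := by
    have e : μ * (3 * δ) = 6 * δ + 128 * m * cV ^ 4 := by rw [hμdef]; field_simp; ring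
    rw [e]; linarith
  -- the package at the final `μ` (radii still `1`, `0`): its derived constants, the letters
  set q₁ : WalkPackage := (oneSitePackage μ 1 1 1 ηs 0 dm).toWalkPackage 1 with hq₁def
  have hq₁ : q₁.Admissible :=
    RefPackage.admissible_toWalkPackage (admissible_oneSitePackage hμ one_pos zero_le_one one_pos hηs hηs1) one_pos
  have hp₁ : q₁.PositiveRates := positiveRates_oneSite one_pos one_pos
  -- (3) the letters: chain below `κ_C⋆`, `ϑ`, `θ₀`
  obtain ⟨θ₀, ϑ, kap, kap', kap'', kap₂, hk0, hk1, hk2, hk3, hk4, hθ₀, hθ₀le, hϑ, hL⟩ :=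
    rungLetters_of_package q₁ hq₁ hp₁ m dm hδ
  have hKbar : 0 ≤ q₁.Kbar := WalkPackage.Kbar_nonneg hq₁
  -- (4) the accretivity radius `R₁` LARGE against `α` (print's bigger analyticity space)
  set R₁ : ℝ := α + 1 + α * (4 * q₁.Kbar + 4) / θ₀ with hR₁def
  have h44 : 0 < 4 * q₁.Kbar + 4 := by linarith
  have hR₁α : α < R₁ := by
    rw [hR₁def]; have := div_nonneg (mul_nonneg hα h44.le) hθ₀.le; linarith
  have hR₁ : 0 < R₁ := lt_of_le_of_lt hα hR₁α
  have hαsmall : α ≤ θ₀ * R₁ / (4 * q₁.Kbar + 4) := by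
    rw [le_div_iff₀ h44, hR₁def]
    have e : θ₀ * (α + 1 + α * (4 * q₁.Kbar + 4) / θ₀) = θ₀ * (α + 1) + α * (4 * q₁.Kbar + 4) := by
      field_simp
    rw [e]
    have : 0 ≤ θ₀ * (α + 1) := mul_nonneg hθ₀.le (by linarith)
    linarith
  -- (5) the analyticity radius `R` against the two `R₁`-thresholds
  set c₁ : ℝ := B6.c0 1 (1 / 2) ^ dm with hc₁def
  set c₂ : ℝ := B6.c0 1 ηs ^ dm with hc₂def
  have hc₁ : 1 ≤ c₁ := one_le_pow₀ (B6Lemma21Arith.one_le_c0 (by norm_num))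
  have hc₂ : 1 ≤ c₂ := one_le_pow₀ (B6Lemma21Arith.one_le_c0 (by simpa using hηs))
  set R : ℝ := 8 * c₁ * R₁ + 8 * c₂ * R₁ + R₁ + 1 with hRdef
  have h8₁ : 0 ≤ 8 * c₁ * R₁ := by positivity
  have h8₂ : 0 ≤ 8 * c₂ * R₁ := by positivity
  have hR : 0 < R := by rw [hRdef]; linarith
  have hR₁R : R₁ < R := by rw [hRdef]; linarith
  have h₁₀ : 8 * c₁ * R₁ ≤ R := by rw [hRdef]; linarith
  have h₁ : 8 * c₂ * R₁ ≤ R := by rw [hRdef]; linarith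
  -- (6) the far-ness `R_σ` LARGE: print's threshold and the two `e^{−R_σ}`-thresholds
  set T : ℝ := Real.log ((4 * q₁.Kbar + 4) / θ₀) / (q₁.mu / 4 - q₁.kapCStar) with hTdef
  set Rσ : ℝ := max T (max (Real.log (8 * c₁)) (Real.log (8 * c₂))) with hRσdef
  have hexp : ∀ {x : ℝ}, 1 ≤ x → Real.log (8 * x) ≤ Rσ → 8 * x * Real.exp (-(1 * Rσ)) ≤ 1 := by
    intro x hx hle
    have h8 : 0 < 8 * x := by linarith
    have h2 : Real.exp (-(1 * Rσ)) ≤ (8 * x)⁻¹ := by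
      rw [one_mul, Real.exp_neg, ← Real.exp_log h8]
      exact inv_anti₀ (Real.exp_pos _) (Real.exp_le_exp.2 hle)
    calc 8 * x * Real.exp (-(1 * Rσ)) ≤ 8 * x * (8 * x)⁻¹ := mul_le_mul_of_nonneg_left h2 h8.le
      _ = 1 := mul_inv_cancel₀ h8.ne'
  have hσ₀ : 8 * c₁ * Real.exp (-(1 * Rσ)) ≤ 1 := hexp hc₁ ((le_max_left _ _).trans (le_max_right _ _))
  have hσ : 8 * c₂ * Real.exp (-(1 * Rσ)) ≤ 1 := hexp hc₂ ((le_max_right _ _).trans (le_max_right _ _))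
  -- (7) the reference package; its W-walks package's derived constants = those of `q₁`
  set rf : RefPackage := oneSitePackage μ R 1 1 ηs Rσ dm with hrfdef
  obtain ⟨eK, eμ, eC, eE, eA⟩ := derived_oneSite_indep μ R 1 1 1 ηs Rσ 0 R₁ 1 dm
  have hrf : rf.Admissible := admissible_oneSitePackage hμ hR zero_le_one one_pos hηs hηs1
  have hcE : 0 ≤ 2 / μ := div_nonneg zero_le_two hμ.le
  have hcE1 : 2 / μ ≤ 1 := by rw [div_le_one hμ]; exact hμ2
  refine ⟨μ, hμ, R, ηs, Rσ, R₁, rf, q₁.Kbar, 4 / q₁.mA, θ₀, ϑ, kap, kap', kap'', kap₂, 2 / μ, rfl, ?_,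
    fun n _ hn => exists_far_sites Rσ n hn, hrf, hR₁, hR₁R, ?_, ?_, ?_, ?_, positiveRates_oneSite one_pos one_pos, ?_,
    hR₁α, ?_, ?_, hθ₀, ?_, ?_, hk0, hk1, hk2, hk3, ?_, hθ₀le, hcE, le_of_eq rfl, fun ν hν => ?_⟩
  · -- `hall`: the reference rung itself needs no threshold
    intro S νs Nfs _ y₀ x₀ hν hfar
    exact uniformWalksAcrossRef_oneSiteFamily c N' E₀ hμ hfar hν
  · -- `hPσ`: `8μ·c₀(1,½)^{d_m}·e^{−R_σ} ≤ μ`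
    show 8 * μ * (((1 : ℕ) : ℝ) * B6.c0 1 (1 / 2) ^ dm) * Real.exp (-(1 * Rσ)) ≤ μ
    rw [Nat.cast_one, one_mul]
    calc 8 * μ * c₁ * Real.exp (-(1 * Rσ)) = μ * (8 * c₁ * Real.exp (-(1 * Rσ))) := by ring
      _ ≤ μ * 1 := mul_le_mul_of_nonneg_left hσ₀ hμ.le
      _ = μ := mul_one μ
  · -- `hP₁`
    show 8 * μ * (((1 : ℕ) : ℝ) * B6.c0 1 (1 / 2) ^ dm) * R₁ ≤ μ * R
    rw [Nat.cast_one, one_mul]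
    calc 8 * μ * c₁ * R₁ = μ * (8 * c₁ * R₁) := by ring
      _ ≤ μ * R := mul_le_mul_of_nonneg_left h₁₀ hμ.le
  · -- `hAσ`
    show 8 * μ * (((1 : ℕ) : ℝ) * B6.c0 1 ηs ^ dm) * Real.exp (-(1 * Rσ)) ≤ μ
    rw [Nat.cast_one, one_mul]
    calc 8 * μ * c₂ * Real.exp (-(1 * Rσ)) = μ * (8 * c₂ * Real.exp (-(1 * Rσ))) := by ring
      _ ≤ μ * 1 := mul_le_mul_of_nonneg_left hσ hμ.le
      _ = μ := mul_one μ
  · -- `hA₁`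
    show 8 * μ * (((1 : ℕ) : ℝ) * B6.c0 1 ηs ^ dm) * R₁ ≤ μ * R
    rw [Nat.cast_one, one_mul]
    calc 8 * μ * c₂ * R₁ = μ * (8 * c₂ * R₁) := by ring
      _ ≤ μ * R := mul_le_mul_of_nonneg_left h₁ hμ.le
  · -- `hη`: `η = etaMax` at `μ = 2` ≤ `etaMax` at the chosen `μ ≥ 2` (monotone, reads neither `η` nor the radii)
    show q₀.etaMax ≤ ((oneSitePackage μ R 1 1 ηs Rσ dm).toWalkPackage R₁).etaMax
    exact etaMax_oneSite_mono (R := 1) (R' := R) (ε := 1) (η := 1) (η' := ηs) (Rσ := 0) (Rσ' := Rσ) (R₁ := 1)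
      (R₁' := R₁) (dm := dm) one_pos two_pos hμ2
  · -- `hKG`
    show (rf.toWalkPackage R₁).Kbar ≤ q₁.Kbar
    rw [eK]
  · -- `hKCs`: `8∕m_{A,0} = 4∕m_A`
    show 8 / μ ≤ 4 / q₁.mA
    have : q₁.mA = μ / 2 := rfl
    rw [this, div_div_eq_mul_div]; norm_num
  · -- `hαsmall`
    show α ≤ θ₀ * R₁ / (4 * (rf.toWalkPackage R₁).Kbar + 4)
    rw [eK]; exact hαsmall
  · -- `hRσlarge`
    show Real.log ((4 * (rf.toWalkPackage R₁).Kbar + 4) / θ₀)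
      / ((rf.toWalkPackage R₁).mu / 4 - (rf.toWalkPackage R₁).kapCStar) ≤ Rσ
    rw [eK, eμ, eC]; exact le_max_left _ _
  · -- `hk4`
    show kap₂ < (rf.toWalkPackage R₁).kapCStar
    rw [eC]; exact hk4
  · -- the four inequalities at `ν ≤ d_m`
    obtain ⟨hE, hS, hδν⟩ := hL ν hν
    have hKc : (rf.toWalkPackage R₁).kapCStar = q₁.kapCStar := eC
    rw [hKc]
    have hP : 0 ≤ 2 * (ϑ * (m * (1 + 2 / kap'') ^ ν)) :=
      mul_nonneg zero_le_two (mul_nonneg hϑ.le (mul_nonneg (Nat.cast_nonneg m) (pow_nonneg (by positivity) ν)))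
    have hSB : 2 * (ϑ * (m * (1 + 2 / kap'') ^ ν)) + B ≤ 1 / 2 - 3 * δ := by rw [hδdef] at hδν ⊢; linarith
    -- the form budget: `(2∕μ)·g ≤ 3δ`
    have hg : 2 / μ * ((((oneSitePackage μ R 1 1 ηs Rσ dm).toWalkPackage R₁).BΓ * (oneSitePackage μ R 1 1 ηs Rσ dm).cV) *
        (((oneSitePackage μ R 1 1 ηs Rσ dm).toWalkPackage R₁).BΓ * (m * B6.c0 1 ηs ^ ν)) / (μ / 2)) ≤ 3 * δ :=
      form_budget_oneSite (R := R) (ε := 1) (κ := 1) (Rσ := Rσ) (R₁ := R₁) hμ1 hηs hν hbud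
    have hg0 : 0 ≤ 2 / μ * ((((oneSitePackage μ R 1 1 ηs Rσ dm).toWalkPackage R₁).BΓ *
          (oneSitePackage μ R 1 1 ηs Rσ dm).cV) *
        (((oneSitePackage μ R 1 1 ηs Rσ dm).toWalkPackage R₁).BΓ * (m * B6.c0 1 ηs ^ ν)) / (μ / 2)) := by
      have hB0 : 0 ≤ ((oneSitePackage μ R 1 1 ηs Rσ dm).toWalkPackage R₁).BΓ :=
        WalkPackage.BΓ_nonneg (RefPackage.admissible_toWalkPackage hrf hR₁)
      have hc0' : 0 ≤ (oneSitePackage μ R 1 1 ηs Rσ dm).cV := RefPackage.cV_nonneg hrf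
      have : 0 ≤ B6.c0 1 ηs ^ ν := pow_nonneg (RefPackage.c0_nonneg hηs) ν
      positivity
    refine ⟨hE, hS, ?_, ?_⟩
    · calc (2 * (ϑ * (m * (1 + 2 / kap'') ^ ν)) + B) * (2 / μ)
          ≤ (2 * (ϑ * (m * (1 + 2 / kap'') ^ ν)) + B) * 1 :=
            mul_le_mul_of_nonneg_left hcE1 (by linarith)
        _ ≤ 1 / 2 := by linarith
    · show (2 * (ϑ * (m * (1 + 2 / kap'') ^ ν)) + B) * (1 + 2 * (2 / μ) *
          ((((oneSitePackage μ R 1 1 ηs Rσ dm).toWalkPackage R₁).BΓ * (oneSitePackage μ R 1 1 ηs Rσ dm).cV) *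
            (((oneSitePackage μ R 1 1 ηs Rσ dm).toWalkPackage R₁).BΓ * (m * B6.c0 1 ηs ^ ν)) / (μ / 2))) ≤ 1 / 2
      set gg := ((((oneSitePackage μ R 1 1 ηs Rσ dm).toWalkPackage R₁).BΓ * (oneSitePackage μ R 1 1 ηs Rσ dm).cV) *
            (((oneSitePackage μ R 1 1 ηs Rσ dm).toWalkPackage R₁).BΓ * (m * B6.c0 1 ηs ^ ν)) / (μ / 2)) with hgg
      calc (2 * (ϑ * (m * (1 + 2 / kap'') ^ ν)) + B) * (1 + 2 * (2 / μ) * gg)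
          = (2 * (ϑ * (m * (1 + 2 / kap'') ^ ν)) + B)
            + (2 * (ϑ * (m * (1 + 2 / kap'') ^ ν)) + B) * (2 * (2 / μ * gg)) := by ring
        _ ≤ (1 / 2 - 3 * δ) + (1 / 2) * (2 * (2 / μ * gg)) := by
            gcongr
            linarith
        _ = (1 / 2 - 3 * δ) + 2 / μ * gg := by ring
        _ ≤ 1 / 2 := by linarith

end Main

end Literature.MathematicalPhysics.QuantumFieldTheory.Balaban1983to89.B13NodeTorusWalksRefRungWitness

end
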